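import Summits.AtomisticToContinuum.HydrodynamicLimit.Theorems.InformationPercolationEngineChaosClosesEulerStressIsotropyC
import Summits.AtomisticToContinuum.HydrodynamicLimit.Theorems.InformationPercolationEngineChaosClosesEulerReadoutMeasurable
import HarnessLib

/-!
# Weak stress isotropy in band (crux `ChaosClosesEuler`, stmt-AtomisticToContinuum-15141, line `Sketch`,
# stub `stub_stressIsotropyOfLocalEquilibrium`) — helper D: measure theory along a good orbit

WHAT. The majorant of the stress-isotropy integrand (helper C) is integrated over `[0, t] × 𝕋³` along ONE good
orbit `s ↦ Φₛz`; this file supplies the measurability / integrability of its pieces: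

* cone-type fields with a merely MEASURABLE velocity mark (the speed tails), the `ψ`-moments, the coarse velocity and
  the Maxwellian moment `(θ, u) ↦ ∫ ψ M_{1,θ,u}` (jointly Borel in the parameters: explicit formula + Fubini
  measurability of a parametric Bochner integral), hence the pointwise-local-equilibrium error
  `|h(ρ_r,u_r,θ_r)| · |MpsiC ψ − ρ_r ∫ψ M_{1,θ_r,u_r}|` read along a measurable curve is jointly measurable in `(s, x)`;
* its uniform bound `2 C_h C_ψ · 3/(πr³)` (the Maxwellian moment of a bounded test is bounded on `{θ > 0}` by
  `MaxwellianMoments`, and `h` vanishes on `{θ ≤ θ₁}`), hence integrability in `x` and of the `x`-integral in `s`;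
* the mean cubic tail `(N+1)⁻¹Σᵢ cubeTail M vᵢ` as an observable: measurable, nonnegative, interval integrable along
  good orbits (bounded by the conserved energy) — the format of `measure_lt_intervalIntegral_flow_le`.

No named fact is invoked.
-/

noncomputable section

namespace Summit.AtomisticToContinuum.HydrodynamicLimit.Theorems.ChaosClosesEulerStressIsotropy

open scoped BigOperators Topology Classical MeasureTheory ENNReal InnerProductSpace
open Filter Set MeasureTheory Function
open Literature.MathematicalPhysics.KineticTheory
open Literature.Analysis.FluidPDE
open Literature.Analysis.FunctionSpaces
open Summit.AtomisticToContinuum.HydrodynamicLimit.Theorems.LocalSecondLawNegative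
open Summit.AtomisticToContinuum.HydrodynamicLimit.Theorems.LocalSecondLawLedger
open Summit.AtomisticToContinuum.HydrodynamicLimit.Theorems.LocalSecondLawLedger.L
  (Mmom rhoC_eq_sum momC_apply_eq_sum momC_eq_sum uC_apply norm_sq_eq_sum)
open Summit.AtomisticToContinuum.HydrodynamicLimit.Theorems.ChaosClosesEulerReduction

variable {N : ℕ}

/-! ## §1 Joint measurability along a measurable curve of configurations -/

section Orbit

variable {γ : ℝ → Phase N} (hγ : Measurable γ) (r : ℝ)
include hγ

/-- Cone-type fields with a measurable velocity mark are jointly measurable along a measurable curve. [folklore] -/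
theorem measurable_sum_cone_mul_of_measurable {c : V3 → ℝ} (hc : Measurable c) :
    Measurable fun p : ℝ × T3 => ∑ i, cone r (γ p.1 i).1 p.2 * c (γ p.1 i).2 := by
  refine Finset.measurable_sum _ fun i _ => ?_
  have hi : Measurable fun s : ℝ => γ s i := (measurable_pi_apply i).comp hγ
  have h0 : Measurable fun p : ℝ × T3 => ((γ p.1 i).1, p.2) := (hi.fst.comp measurable_fst).prodMk measurable_snd
  have h1 : Measurable fun p : ℝ × T3 => uncurry (cone r) ((γ p.1 i).1, p.2) :=
    (ChaosClosesEulerReadout.continuous_uncurry_cone r).measurable.comp h0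
  simp only [uncurry_apply_pair] at h1
  exact h1.mul (hc.comp (hi.snd.comp measurable_fst))

/-- The `ψ`-moment of a measurable `ψ` along a measurable curve is jointly measurable. [folklore] -/
theorem measurable_MpsiC_orbit {ψ : V3 → ℝ} (hψ : Measurable ψ) :
    Measurable fun p : ℝ × T3 => MpsiC r (γ p.1) p.2 ψ := by
  have heq : (fun p : ℝ × T3 => MpsiC r (γ p.1) p.2 ψ) =
      fun p => ((N + 1 : ℕ) : ℝ)⁻¹ * ∑ i, cone r (γ p.1 i).1 p.2 * ψ (γ p.1 i).2 := by
    funext p; exact MpsiC_eq_sum r _ _ ψ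
  rw [heq]
  exact measurable_const.mul (measurable_sum_cone_mul_of_measurable hγ r hψ)

/-- The coarse velocity along a measurable curve is jointly measurable. [folklore] -/
theorem measurable_uC_orbit : Measurable fun p : ℝ × T3 => uC r (γ p.1) p.2 := by
  unfold uC
  exact (measurable_rhoC_orbit hγ r).inv.smul (measurable_momC_orbit hγ r)

end Orbit

/-! ## §2 The Maxwellian moment as a measurable function of the state -/

/-- The local Maxwellian `M_{1,θ,u}(v)` is jointly Borel in the state `(θ, u)` and the variable `v` (explicit
formula), in the uncurried format of a parametric integrand. [folklore] -/
theorem measurable_localMaxwellian_state_var :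
    Measurable fun s : (ℝ × V3) × V3 => localMaxwellian 1 s.1.1 s.1.2 s.2 := by
  -- adapted from `Cruxes/EnergyFluxLocality/Lines/kinetic_truncation.lean` (`measurable_localMaxwellian_param`)
  unfold localMaxwellian
  have h1 : Measurable fun s : (ℝ × V3) × V3 => (2 * Real.pi * s.1.1) ^ (-(Module.finrank ℝ V3 : ℝ) / 2) :=
    (measurable_const.mul measurable_fst.fst).pow_const _
  have h2 : Measurable fun s : (ℝ × V3) × V3 => Real.exp (-‖s.2 - s.1.2‖ ^ 2 / (2 * s.1.1)) :=
    Real.measurable_exp.comp (((measurable_snd.sub measurable_fst.snd).norm.pow_const 2).neg.div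
      (measurable_const.mul measurable_fst.fst))
  exact (measurable_const.mul h1).mul h2

/-- **The Maxwellian moment of a measurable test is Borel in the state**:
`(θ, u) ↦ ∫ ψ(v) M_{1,θ,u}(v) dv` is measurable (Fubini measurability of a parametric Bochner integral). [folklore] -/
theorem measurable_maxwellMoment {ψ : V3 → ℝ} (hψ : Measurable ψ) :
    Measurable fun q : ℝ × V3 => ∫ v, ψ v * localMaxwellian 1 q.1 q.2 v := by
  have hF : Measurable fun s : (ℝ × V3) × V3 => ψ s.2 * localMaxwellian 1 s.1.1 s.1.2 s.2 :=
    (hψ.comp measurable_snd).mul measurable_localMaxwellian_state_var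
  exact (hF.stronglyMeasurable.integral_prod_right' (ν := (volume : Measure V3))).measurable

/-- **The pointwise-local-equilibrium error along a measurable curve is jointly measurable in `(s, x)`.**
[folklore] -/
theorem measurable_pleErr_orbit {γ : ℝ → Phase N} (hγ : Measurable γ) (r : ℝ) {ψ : V3 → ℝ} (hψ : Measurable ψ)
    {h : ℝ × V3 × ℝ → ℝ} (hh : Measurable h) :
    Measurable fun p : ℝ × T3 =>
      |h (rhoC r (γ p.1) p.2, uC r (γ p.1) p.2, thetaC r (γ p.1) p.2)| *
        |MpsiC r (γ p.1) p.2 ψ - rhoC r (γ p.1) p.2 *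
          ∫ v, ψ v * localMaxwellian 1 (thetaC r (γ p.1) p.2) (uC r (γ p.1) p.2) v| := by
  have hρ := measurable_rhoC_orbit hγ r
  have hu := measurable_uC_orbit hγ r
  have hθ := measurable_thetaC_orbit hγ r
  have h1 : Measurable fun p : ℝ × T3 => h (rhoC r (γ p.1) p.2, uC r (γ p.1) p.2, thetaC r (γ p.1) p.2) :=
    hh.comp (hρ.prodMk (hu.prodMk hθ))
  have h2 : Measurable fun p : ℝ × T3 =>
      ∫ v, ψ v * localMaxwellian 1 (thetaC r (γ p.1) p.2) (uC r (γ p.1) p.2) v :=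
    (measurable_maxwellMoment hψ).comp (hθ.prodMk hu)
  exact (h1.comp measurable_id).abs.mul (((measurable_MpsiC_orbit hγ r hψ).sub (hρ.mul h2)).abs)

/-! ## §3 Bounds and integrability of the pointwise-local-equilibrium error -/

/-- **The Maxwellian moment of a bounded test is bounded on `{θ > 0}`** (from `MaxwellianMoments`: `M_{1,θ,u} dv` is
a probability). [folklore] -/
theorem abs_maxwellMoment_le
    (hMM : ∀ (ρ θ : ℝ) (u : V3), 0 < ρ → 0 < θ →
      let m : Measure V3 := volume.withDensity (fun v => ENNReal.ofReal (localMaxwellian ρ θ u v))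
      IsFiniteMeasure m ∧ Integrable (fun v : V3 => ‖v‖ ^ 2) m ∧
      (m Set.univ).toReal = ρ ∧ (∀ j : Fin 3, ∫ v, v j ∂m = ρ * u j) ∧
      (∀ j k : Fin 3, ∫ v, v j * v k ∂m = ρ * (u j * u k + if j = k then θ else 0)) ∧
      (∫ v, ‖v‖ ^ 2 ∂m = ρ * (‖u‖ ^ 2 + 3 * θ)) ∧
      (∀ ψ : V3 → ℝ, Continuous ψ → (∃ C : ℝ, ∀ v, |ψ v| ≤ C) →
        Integrable ψ m ∧ ∫ v, ψ v ∂m = ρ * ∫ v, ψ v * localMaxwellian 1 θ u v))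
    {θ : ℝ} (hθ : 0 < θ) (u : V3) {ψ : V3 → ℝ} (hψc : Continuous ψ) {C : ℝ} (hψb : ∀ v, |ψ v| ≤ C) :
    |∫ v, ψ v * localMaxwellian 1 θ u v| ≤ C := by
  obtain ⟨hfin, -, hmass, -, -, -, hψ⟩ := hMM 1 θ u one_pos hθ
  set m : Measure V3 := volume.withDensity (fun v => ENNReal.ofReal (localMaxwellian 1 θ u v)) with hm
  haveI := hfin
  obtain ⟨-, hI⟩ := hψ ψ hψc ⟨C, hψb⟩
  rw [one_mul] at hI
  rw [← hI]
  have h := norm_integral_le_of_norm_le_const (μ := m) (f := ψ) (C := C)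
    (ae_of_all _ fun v => by rw [Real.norm_eq_abs]; exact hψb v)
  rwa [measureReal_def, hmass, mul_one, Real.norm_eq_abs] at h

/-- **Uniform bound of the weighted pointwise-local-equilibrium error**: if `|ψ| ≤ C_ψ`, `|h| ≤ C_h` and `h`
vanishes on `{θ ≤ θ₁}` (`θ₁ > 0`), then `|h(ρ_r,u_r,θ_r)| |MpsiC ψ − ρ_r∫ψM| ≤ 2 C_h C_ψ · 3/(πr³)`. [folklore] -/
theorem weighted_pleErr_le
    (hMM : ∀ (ρ θ : ℝ) (u : V3), 0 < ρ → 0 < θ →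
      let m : Measure V3 := volume.withDensity (fun v => ENNReal.ofReal (localMaxwellian ρ θ u v))
      IsFiniteMeasure m ∧ Integrable (fun v : V3 => ‖v‖ ^ 2) m ∧
      (m Set.univ).toReal = ρ ∧ (∀ j : Fin 3, ∫ v, v j ∂m = ρ * u j) ∧
      (∀ j k : Fin 3, ∫ v, v j * v k ∂m = ρ * (u j * u k + if j = k then θ else 0)) ∧
      (∫ v, ‖v‖ ^ 2 ∂m = ρ * (‖u‖ ^ 2 + 3 * θ)) ∧
      (∀ ψ : V3 → ℝ, Continuous ψ → (∃ C : ℝ, ∀ v, |ψ v| ≤ C) →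
        Integrable ψ m ∧ ∫ v, ψ v ∂m = ρ * ∫ v, ψ v * localMaxwellian 1 θ u v))
    {r : ℝ} (hr : 0 < r) (w : Phase N) (x : T3) {ψ : V3 → ℝ} (hψc : Continuous ψ) {Cψ : ℝ}
    (hψb : ∀ v, |ψ v| ≤ Cψ) {h : ℝ × V3 × ℝ → ℝ} {Ch : ℝ} (hhb : ∀ p, |h p| ≤ Ch) {θ₁ : ℝ} (hθ₁ : 0 < θ₁)
    (hh0 : ∀ p : ℝ × V3 × ℝ, p.2.2 ≤ θ₁ → h p = 0) :
    |h (rhoC r w x, uC r w x, thetaC r w x)| *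
        |MpsiC r w x ψ - rhoC r w x * ∫ v, ψ v * localMaxwellian 1 (thetaC r w x) (uC r w x) v| ≤
      2 * Ch * Cψ * (3 / (Real.pi * r ^ 3)) := by
  have hCψ : 0 ≤ Cψ := (abs_nonneg _).trans (hψb 0)
  have hCh : 0 ≤ Ch := (abs_nonneg _).trans (hhb (0, 0, 0))
  have hρ0 := rhoC_nonneg hr w x
  have hρle := rhoC_le hr w x
  by_cases hθ : thetaC r w x ≤ θ₁
  · rw [hh0 _ hθ, abs_zero, zero_mul]; positivity
  · rw [not_le] at hθ
    have hθpos : 0 < thetaC r w x := hθ₁.trans hθ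
    have h1 : |MpsiC r w x ψ| ≤ Cψ * rhoC r w x := abs_MpsiC_le_mul_rhoC hr w x hψb
    have h2 : |rhoC r w x * ∫ v, ψ v * localMaxwellian 1 (thetaC r w x) (uC r w x) v| ≤ rhoC r w x * Cψ := by
      rw [abs_mul, abs_of_nonneg hρ0]
      exact mul_le_mul_of_nonneg_left (abs_maxwellMoment_le hMM hθpos _ hψc hψb) hρ0
    have h3 : |MpsiC r w x ψ - rhoC r w x * ∫ v, ψ v * localMaxwellian 1 (thetaC r w x) (uC r w x) v| ≤
        2 * Cψ * (3 / (Real.pi * r ^ 3)) := by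
      refine (abs_sub _ _).trans ?_
      have h4 : Cψ * rhoC r w x ≤ Cψ * (3 / (Real.pi * r ^ 3)) := mul_le_mul_of_nonneg_left hρle hCψ
      linarith
    calc _ ≤ Ch * (2 * Cψ * (3 / (Real.pi * r ^ 3))) := mul_le_mul (hhb _) h3 (abs_nonneg _) hCh
      _ = _ := by ring

/-- **Integrability in `x` of the weighted error, for one configuration.** [folklore] -/
theorem integrable_weighted_pleErr
    (hMM : ∀ (ρ θ : ℝ) (u : V3), 0 < ρ → 0 < θ →
      let m : Measure V3 := volume.withDensity (fun v => ENNReal.ofReal (localMaxwellian ρ θ u v))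
      IsFiniteMeasure m ∧ Integrable (fun v : V3 => ‖v‖ ^ 2) m ∧
      (m Set.univ).toReal = ρ ∧ (∀ j : Fin 3, ∫ v, v j ∂m = ρ * u j) ∧
      (∀ j k : Fin 3, ∫ v, v j * v k ∂m = ρ * (u j * u k + if j = k then θ else 0)) ∧
      (∫ v, ‖v‖ ^ 2 ∂m = ρ * (‖u‖ ^ 2 + 3 * θ)) ∧
      (∀ ψ : V3 → ℝ, Continuous ψ → (∃ C : ℝ, ∀ v, |ψ v| ≤ C) →
        Integrable ψ m ∧ ∫ v, ψ v ∂m = ρ * ∫ v, ψ v * localMaxwellian 1 θ u v))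
    {r : ℝ} (hr : 0 < r) (w : Phase N) {ψ : V3 → ℝ} (hψc : Continuous ψ) {Cψ : ℝ}
    (hψb : ∀ v, |ψ v| ≤ Cψ) {h : ℝ × V3 × ℝ → ℝ} (hhc : Continuous h) {Ch : ℝ} (hhb : ∀ p, |h p| ≤ Ch) {θ₁ : ℝ}
    (hθ₁ : 0 < θ₁) (hh0 : ∀ p : ℝ × V3 × ℝ, p.2.2 ≤ θ₁ → h p = 0) :
    Integrable (fun x => |h (rhoC r w x, uC r w x, thetaC r w x)| *
      |MpsiC r w x ψ - rhoC r w x * ∫ v, ψ v * localMaxwellian 1 (thetaC r w x) (uC r w x) v|) volume := by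
  have hm := (measurable_pleErr_orbit (γ := fun _ : ℝ => w) measurable_const r hψc.measurable hhc.measurable).comp
    (measurable_const.prodMk measurable_id : Measurable fun x : T3 => ((0 : ℝ), x))
  refine Integrable.of_bound hm.aestronglyMeasurable (2 * Ch * Cψ * (3 / (Real.pi * r ^ 3)))
    (ae_of_all _ fun x => ?_)
  rw [Real.norm_eq_abs, abs_of_nonneg (mul_nonneg (abs_nonneg _) (abs_nonneg _))]
  exact weighted_pleErr_le hMM hr w x hψc hψb hhb hθ₁ hh0

/-- **Integrability in `s` of the `x`-integrated weighted error along a good orbit.** [folklore] -/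
theorem integrableOn_weighted_pleErr
    (hMM : ∀ (ρ θ : ℝ) (u : V3), 0 < ρ → 0 < θ →
      let m : Measure V3 := volume.withDensity (fun v => ENNReal.ofReal (localMaxwellian ρ θ u v))
      IsFiniteMeasure m ∧ Integrable (fun v : V3 => ‖v‖ ^ 2) m ∧
      (m Set.univ).toReal = ρ ∧ (∀ j : Fin 3, ∫ v, v j ∂m = ρ * u j) ∧
      (∀ j k : Fin 3, ∫ v, v j * v k ∂m = ρ * (u j * u k + if j = k then θ else 0)) ∧
      (∫ v, ‖v‖ ^ 2 ∂m = ρ * (‖u‖ ^ 2 + 3 * θ)) ∧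
      (∀ ψ : V3 → ℝ, Continuous ψ → (∃ C : ℝ, ∀ v, |ψ v| ≤ C) →
        Integrable ψ m ∧ ∫ v, ψ v ∂m = ρ * ∫ v, ψ v * localMaxwellian 1 θ u v))
    {ε : ℝ} (Φ : HardSphereFlow (Torus.geometry (Fin 3)) ε (N + 1)) {z : Phase N} (hz : z ∈ Φ.good)
    {r : ℝ} (hr : 0 < r) {ψ : V3 → ℝ} (hψc : Continuous ψ) {Cψ : ℝ}
    (hψb : ∀ v, |ψ v| ≤ Cψ) {h : ℝ × V3 × ℝ → ℝ} (hhc : Continuous h) {Ch : ℝ} (hhb : ∀ p, |h p| ≤ Ch) {θ₁ : ℝ}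
    (hθ₁ : 0 < θ₁) (hh0 : ∀ p : ℝ × V3 × ℝ, p.2.2 ≤ θ₁ → h p = 0) (a b : ℝ) :
    IntegrableOn (fun s => ∫ x, |h (rhoC r (Φ.flow s z) x, uC r (Φ.flow s z) x, thetaC r (Φ.flow s z) x)| *
      |MpsiC r (Φ.flow s z) x ψ - rhoC r (Φ.flow s z) x *
        ∫ v, ψ v * localMaxwellian 1 (thetaC r (Φ.flow s z) x) (uC r (Φ.flow s z) x) v|) (Set.Icc a b) volume := by
  have hγ : Measurable fun s => Φ.flow s z := (Φ.isTrajectory z hz).measurable_torus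
  have hm := measurable_pleErr_orbit hγ r hψc.measurable hhc.measurable
  refine ChaosClosesEulerReadout.integrableOn_integral_of_bdd (C := 2 * Ch * Cψ * (3 / (Real.pi * r ^ 3)))
    hm.aestronglyMeasurable fun s _ x => ?_
  rw [Real.norm_eq_abs, abs_of_nonneg (mul_nonneg (abs_nonneg _) (abs_nonneg _))]
  exact weighted_pleErr_le hMM hr _ x hψc hψb hhb hθ₁ hh0

/-! ## §4 The mean tails as observables -/

/-- The mean cubic tail `(N+1)⁻¹ Σᵢ cubeTail M vᵢ` is a measurable observable. [folklore] -/
theorem measurable_mean_cubeTail (M : ℝ) :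
    Measurable fun w : Phase N => ((N : ℝ) + 1)⁻¹ * ∑ i, cubeTail M (w i).2 :=
  measurable_const.mul (Finset.measurable_sum _ fun i _ =>
    (measurable_cubeTail M).comp ((measurable_pi_apply i).snd))

/-- The mean quadratic tail `(N+1)⁻¹ Σᵢ sqTail M vᵢ` is a measurable observable. [folklore] -/
theorem measurable_mean_sqTail (M : ℝ) :
    Measurable fun w : Phase N => ((N + 1 : ℕ) : ℝ)⁻¹ * ∑ i, sqTail M (w i).2 :=
  measurable_const.mul (Finset.measurable_sum _ fun i _ =>
    (measurable_sqTail M).comp ((measurable_pi_apply i).snd))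

/-- Energy conservation on the good set, in terms of `ke`, for a flow of any diameter. [folklore] -/
theorem ke_flow_eq' {ε : ℝ} (Φ : HardSphereFlow (Torus.geometry (Fin 3)) ε (N + 1)) {z : Phase N}
    (hz : z ∈ Φ.good) (s : ℝ) : ke (Φ.flow s z) = ke z := by
  rw [ke_eq_configEnergy, ke_eq_configEnergy, Φ.configEnergy_flow hz s]

/-- **The mean cubic tail is integrable on a window along good orbits** (measurable in time, bounded by the
conserved energy). [folklore] -/
theorem integrableOn_mean_cubeTail {ε : ℝ} (Φ : HardSphereFlow (Torus.geometry (Fin 3)) ε (N + 1))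
    (M : ℝ) {z : Phase N} (hz : z ∈ Φ.good) (a b : ℝ) :
    IntegrableOn (fun s => ((N : ℝ) + 1)⁻¹ * ∑ i, cubeTail M ((Φ.flow s z) i).2) (Set.Icc a b) volume := by
  have hγ : Measurable fun s => Φ.flow s z := (Φ.isTrajectory z hz).measurable_torus
  have hm : Measurable fun s => ((N : ℝ) + 1)⁻¹ * ∑ i, cubeTail M ((Φ.flow s z) i).2 :=
    (measurable_mean_cubeTail M).comp hγ
  have hN : ((N : ℝ) + 1) = ((N + 1 : ℕ) : ℝ) := by push_cast; ring
  refine Measure.integrableOn_of_bounded (M := 2 * ke z * Real.sqrt (2 * ((N + 1 : ℕ) : ℝ) * ke z)) ?_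
    hm.aestronglyMeasurable (ae_of_all _ fun s => ?_)
  · rw [Real.volume_Icc]; exact ENNReal.ofReal_ne_top
  · rw [Real.norm_eq_abs, abs_of_nonneg (mul_nonneg (by positivity)
      (Finset.sum_nonneg fun i _ => cubeTail_nonneg M _)), hN, ← ke_flow_eq' Φ hz s]
    exact mean_cubeTail_le M _

/-- **The mean cubic tail is interval integrable along good orbits.** [folklore] -/
theorem intervalIntegrable_mean_cubeTail {ε : ℝ} (Φ : HardSphereFlow (Torus.geometry (Fin 3)) ε (N + 1))
    (M : ℝ) {z : Phase N} (hz : z ∈ Φ.good) {a b : ℝ} (hab : a ≤ b) :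
    IntervalIntegrable (fun s => ((N : ℝ) + 1)⁻¹ * ∑ i, cubeTail M ((Φ.flow s z) i).2) volume a b := by
  refine MeasureTheory.IntegrableOn.intervalIntegrable ?_
  rw [Set.uIcc_of_le hab]
  exact integrableOn_mean_cubeTail Φ M hz a b

/-- **The mean quadratic tail is integrable on a window along good orbits.** [folklore] -/
theorem integrableOn_mean_sqTail {ε : ℝ} (Φ : HardSphereFlow (Torus.geometry (Fin 3)) ε (N + 1))
    (M : ℝ) {z : Phase N} (hz : z ∈ Φ.good) (a b : ℝ) :
    IntegrableOn (fun s => ((N + 1 : ℕ) : ℝ)⁻¹ * ∑ i, sqTail M ((Φ.flow s z) i).2) (Set.Icc a b) volume := by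
  have hγ : Measurable fun s => Φ.flow s z := (Φ.isTrajectory z hz).measurable_torus
  have hm : Measurable fun s => ((N + 1 : ℕ) : ℝ)⁻¹ * ∑ i, sqTail M ((Φ.flow s z) i).2 :=
    (measurable_mean_sqTail M).comp hγ
  refine Measure.integrableOn_of_bounded (M := 2 * ke z) ?_ hm.aestronglyMeasurable (ae_of_all _ fun s => ?_)
  · rw [Real.volume_Icc]; exact ENNReal.ofReal_ne_top
  · rw [Real.norm_eq_abs, abs_of_nonneg (mul_nonneg (by positivity)
      (Finset.sum_nonneg fun i _ => sqTail_nonneg M _)), ← ke_flow_eq' Φ hz s]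
    exact mean_sqTail_le_two_ke M _

/-- The cubic tail decreases with the level. [folklore] -/
theorem cubeTail_antitone {M M' : ℝ} (hMM : M ≤ M') (v : V3) : cubeTail M' v ≤ cubeTail M v := by
  by_cases h : M' < ‖v‖
  · unfold cubeTail
    rw [Set.indicator_of_mem (show v ∈ {v : V3 | M' < ‖v‖} from h),
      Set.indicator_of_mem (show v ∈ {v : V3 | M < ‖v‖} from hMM.trans_lt h)]
  · have h0 : cubeTail M' v = 0 := Set.indicator_of_notMem (show v ∉ {v : V3 | M' < ‖v‖} from h) _
    rw [h0]
    exact cubeTail_nonneg M v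

/-! ## §5 Registered sub-goal -/

/-- **Registered sub-goal `stub_stressIsotropyMaxwellMeasurable` (helper D of `stub_stressIsotropyOfLocalEquilibrium`):
the Maxwellian moment of a measurable test is Borel in the state `(θ, u)`** — the measurability behind every Fubini
step on the Maxwellian side of pointwise local equilibrium. [folklore] -/
theorem stub_stressIsotropyMaxwellMeasurable : ∀ {ψ : V3 → ℝ}, Measurable ψ → Measurable fun q : ℝ × V3 => ∫ v, ψ v * localMaxwellian 1 q.1 q.2 v :=
  fun hψ => measurable_maxwellMoment hψ

end Summit.AtomisticToContinuum.HydrodynamicLimit.Theorems.ChaosClosesEulerStressIsotropy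

end
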